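import Summits.Ventures.LatticeQCDFlow.Exactness.FlowSamplerSymmetrisation
import Summits.Ventures.LatticeQCDFlow.Exactness.FlowSamplerSquareIntegrableCeiling
import Mathlib.Analysis.Convex.Mul
import Literature.Probability.MarkovChains.MixtureProposalPeskun
import HarnessLib

/-!
# AVERAGING A FLOW OVER ANY FINITE FAMILY OF SYMMETRIES IS FREE: `q̄ = |G|⁻¹ Σ_t q̃∘t` never rejects more, never has a larger importance-weight moment or sticking column, and an orbit cover makes it uniformly ergodic

HONEST FRAMING: exact (Metropolis-corrected) sampling algorithms for lattice gauge theory;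
figures of merit are autocorrelation/cost numbers at stated couplings and volumes; no
continuum-physics claim.  (SCALAR calibration rung S0-A: not a gauge result.)

Venture `LatticeQCDFlow` (cell pub-lqcd), topic `Exactness`; FANOUT row 2 (`s0-phi4`, FLOW arm
`K = imhOp μ w q̃`).  NEW WORK of the cell: the finite-family version of `FlowSamplerSymmetrisation`
(there: one involution `σ`, the `Z₂` of φ⁴).  Setting: s-finite `(X, μ)`, a FINITE NONEMPTY FAMILY
`t : ι → (X ≃ᵐ X)` of measure-preserving measurable bijections leaving the target weight invariant
(`w ∘ t_i = w`; lattice examples: the `Z₂` sign flip, translations and rotations of a periodic lattice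
with symmetric couplings, the `Z_N` centre of `SU(N)` gauge theory, charge conjugation), and ANY
positive normalised model density `q̃`.  The averaged proposal "draw `φ' ∼ q̃`, pick `i` uniformly,
output `t_i⁻¹ φ'`" has density `q̄ = N⁻¹ Σ_i q̃ ∘ t_i` (`N = |ι|`; no group structure is needed for
anything below — closure under composition only matters for making `q̄` itself invariant).  This is
the 'single-model symmetrized mixture' of Boyda et al. 2021 / Hackett et al. 2021 §4.2 (NAMED, used
there empirically); typed here are its GUARANTEES, by `N`-point convexity (Jensen for `x ↦ 1/x`,
`convexOn_zpow`) and the change of variables `∫ F ∘ t_i = ∫ F`.  IN THE TREE, NOT RESTATED: the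
nearest printed statement is Tierney 1998 Prop. 5 / Liu 2001 Thm 13.3.4 — the Metropolis kernel of a
MIXTURE proposal Peskun-dominates the mixture of the Metropolis kernels — formalised (finite state
space) as `Literature.Probability.MarkovChains.MixtureProposalPeskun`, whose "simple inequality"
`sum_min_le_min_sum` is reused here; that theorem compares `K_q̄` with `N⁻¹Σ_i K_{q̃∘t_i}`, while the
columns below are compared with the un-averaged `K_q̃` itself.

## What is proved (`r_q(x)` the rejection probability of `imhOp μ w q` from `x`)

* `groupAvg_facts` — `q̄ > 0`, measurable, integrable, `∫ q̄ = 1`;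
* **`groupAvg_rejection_le`** — POINTWISE `r_q̄(x) ≤ N⁻¹ Σ_i r_q̃(t_i x)` (`min` is superadditive);
* **`groupAvg_meanRejection_le`** — `∫ r_q̄ w ≤ ∫ r_q̃ w`: the acceptance rate never drops;
* **`groupAvg_weightMoment_le`** — `∫ w²/q̄ ≤ ∫ w²/q̃`: the importance-sampling ESS never drops;
* **`groupAvg_stickingColumn_le`** — for `g² ∘ t_i = g²` (all `i`): `∫ g² w r_q̄/(1 − r_q̄) ≤ ∫ g² w r_q̃/(1 − r_q̃)`;
* **`groupAvg_tauInt_le_of_orbitCover`** — ORBIT COVER `∀ x ∃ i, w(x) ≤ C q̃(t_i x)` ⇒ `w ≤ N C q̄`, so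
  every centred square-integrable observable has a summable series under `imhOp μ w q̄` with
  `τ_int ≤ N C/Z − ½` (a flow covering ONE representative of every orbit samples all of them).

NOT CLAIMED: any value for any network; per-cost statements (`q̄` costs `N` density evaluations per
proposal unless the flow is equivariant, in which case `q̄ = q̃` and nothing changes); the odd-sector
exactness and the Dirichlet-form `τ_int` ordering (those use the group structure; `Z₂` case in
`FlowSamplerSymmetrisation{,Dirichlet}`); lattice instances beyond `Z₂` (they need symmetric
couplings, which the tree's generic `J` does not assume).
-/

namespace Summit.Ventures.LatticeQCDFlow.Exactness

open Real MeasureTheory Filter Finset Set Topology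
open Summit.Ventures.LatticeQCDFlow.Scoring

/-- `N`-point AM–HM: for positive `a_i`, `1/(N⁻¹ Σ a_i) ≤ N⁻¹ Σ 1/a_i` (Jensen for `x ↦ x⁻¹`). -/
theorem inv_avg_le_avg_inv {ι : Type*} [Fintype ι] [Nonempty ι] {a : ι → ℝ} (ha : ∀ i, 0 < a i) :
    1 / ((∑ i, a i) / Fintype.card ι) ≤ (∑ i, 1 / a i) / Fintype.card ι := by
  have hN : (0 : ℝ) < Fintype.card ι := by exact_mod_cast Fintype.card_pos
  have hcv : ConvexOn ℝ (Set.Ioi (0 : ℝ)) (fun x : ℝ => x⁻¹) := by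
    simpa [zpow_neg_one] using (convexOn_zpow (-1) : ConvexOn ℝ (Set.Ioi (0 : ℝ)) fun x : ℝ => x ^ (-1 : ℤ))
  have h := hcv.map_sum_le
    (t := Finset.univ) (w := fun _ => 1 / (Fintype.card ι : ℝ)) (p := a)
    (fun i _ => (div_pos one_pos hN).le)
    (by rw [Finset.sum_const, Finset.card_univ, nsmul_eq_mul]; field_simp)
    (fun i _ => Set.mem_Ioi.2 (ha i))
  simp only [smul_eq_mul] at h
  have e1 : ∑ i, 1 / (Fintype.card ι : ℝ) * a i = (∑ i, a i) / Fintype.card ι := by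
    rw [← Finset.mul_sum]; ring
  have e2 : ∑ i, 1 / (Fintype.card ι : ℝ) * (a i)⁻¹ = (∑ i, 1 / a i) / Fintype.card ι := by
    rw [← Finset.mul_sum, Finset.sum_congr rfl fun i _ => (one_div (a i)).symm]; ring
  rw [e1, e2] at h
  simpa [one_div] using h

/-- The odds map under an average: `r_i < 1`, `m ≤ N⁻¹ Σ r_i` ⇒
`m/(1 − m) ≤ N⁻¹ Σ r_i/(1 − r_i)` (monotone, then AM–HM on `1 − r_i`). -/
theorem odds_le_avg_odds {ι : Type*} [Fintype ι] [Nonempty ι] {r : ι → ℝ} {m : ℝ}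
    (hr : ∀ i, r i < 1) (hm : m ≤ (∑ i, r i) / Fintype.card ι) :
    m / (1 - m) ≤ (∑ i, r i / (1 - r i)) / Fintype.card ι := by
  have hN : (0 : ℝ) < Fintype.card ι := by exact_mod_cast Fintype.card_pos
  have hu : ∀ i, 0 < 1 - r i := fun i => by linarith [hr i]
  -- the average is `< 1`
  have havg : (∑ i, r i) / Fintype.card ι < 1 := by
    rw [div_lt_one hN]
    calc ∑ i, r i < ∑ _i : ι, (1 : ℝ) := Finset.sum_lt_sum_of_nonempty Finset.univ_nonempty
          fun i _ => hr i
      _ = Fintype.card ι := by simp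
  have hm1 : m < 1 := lt_of_le_of_lt hm havg
  have e : ∀ s : ℝ, s < 1 → s / (1 - s) = 1 / (1 - s) - 1 := fun s hs => by
    have h : (1 - s) ≠ 0 := by linarith
    field_simp
    ring
  have hAM := inv_avg_le_avg_inv (a := fun i => 1 - r i) hu
  have e1 : (∑ i, (1 - r i)) / Fintype.card ι = 1 - (∑ i, r i) / Fintype.card ι := by
    rw [Finset.sum_sub_distrib, Finset.sum_const, Finset.card_univ, nsmul_eq_mul, mul_one]
    field_simp
  rw [e1] at hAM
  have h1 : 1 / (1 - m) ≤ 1 / (1 - (∑ i, r i) / Fintype.card ι) :=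
    one_div_le_one_div_of_le (by linarith) (by linarith)
  have e2 : (∑ i, r i / (1 - r i)) / Fintype.card ι = (∑ i, 1 / (1 - r i)) / Fintype.card ι - 1 := by
    have : ∑ i, r i / (1 - r i) = ∑ i, (1 / (1 - r i) - 1) :=
      Finset.sum_congr rfl fun i _ => e (r i) (hr i)
    rw [this, Finset.sum_sub_distrib, Finset.sum_const, Finset.card_univ, nsmul_eq_mul, mul_one]
    field_simp
  rw [e m hm1, e2]
  linarith

section General

variable {X : Type*} [MeasurableSpace X] {μ : Measure X} [SFinite μ] {w q : X → ℝ}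
  {ι : Type*} [Fintype ι] [Nonempty ι] {t : ι → X ≃ᵐ X}

omit [SFinite μ] [Fintype ι] [Nonempty ι] in
/-- Change of variables along each symmetry: `∫ F(t_i x) = ∫ F`, and `F ∘ t_i ∈ L¹` when `F ∈ L¹`. -/
theorem integral_comp_symmetry (ht : ∀ i, MeasurePreserving (t i) μ μ) (i : ι) (F : X → ℝ) :
    ∫ x, F (t i x) ∂μ = ∫ x, F x ∂μ :=
  (ht i).integral_comp (t i).measurableEmbedding F

omit [SFinite μ] [Fintype ι] [Nonempty ι] in
/-- `F ∘ t_i ∈ L¹(μ)` whenever `F ∈ L¹(μ)`. -/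
theorem integrable_comp_symmetry (ht : ∀ i, MeasurePreserving (t i) μ μ) (i : ι) {F : X → ℝ}
    (hF : Integrable F μ) : Integrable (fun x => F (t i x)) μ :=
  ((ht i).integrable_comp_emb (t i).measurableEmbedding).2 hF

omit [SFinite μ] in
/-- **`q̄ = N⁻¹ Σ_i q̃ ∘ t_i` is a positive, measurable, normalised model density.** -/
theorem groupAvg_facts (ht : ∀ i, MeasurePreserving (t i) μ μ) (hq0 : ∀ x, 0 < q x)
    (hqm : Measurable q) (hqi : Integrable q μ) (hq1 : ∫ z, q z ∂μ = 1) :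
    (∀ x, 0 < (∑ i, q (t i x)) / Fintype.card ι) ∧
    Measurable (fun x => (∑ i, q (t i x)) / Fintype.card ι) ∧
    Integrable (fun x => (∑ i, q (t i x)) / Fintype.card ι) μ ∧
    (∫ x, (∑ i, q (t i x)) / Fintype.card ι ∂μ = 1) := by
  have hN : (0 : ℝ) < Fintype.card ι := by exact_mod_cast Fintype.card_pos
  have hqi' : ∀ i, Integrable (fun x => q (t i x)) μ := fun i => integrable_comp_symmetry ht i hqi
  refine ⟨fun x => div_pos (Finset.sum_pos (fun i _ => hq0 _) Finset.univ_nonempty) hN,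
    (Finset.measurable_sum _ fun i _ => hqm.comp (t i).measurable).div_const _,
    (integrable_finsetSum Finset.univ fun i _ => hqi' i).div_const _, ?_⟩
  rw [integral_div, integral_finsetSum Finset.univ fun i _ => hqi' i]
  have e : ∀ i, ∫ x, q (t i x) ∂μ = 1 := fun i => by rw [integral_comp_symmetry ht i q, hq1]
  simp only [e, Finset.sum_const, Finset.card_univ, nsmul_eq_mul, mul_one]
  exact div_self hN.ne'

/-! ## Acceptance -/

omit [SFinite μ] in
/-- **AVERAGING NEVER REJECTS MORE, POINTWISE**: `r_q̄(x) ≤ N⁻¹ Σ_i r_q̃(t_i x)` (`w ∘ t_i = w`). -/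
theorem groupAvg_rejection_le (ht : ∀ i, MeasurePreserving (t i) μ μ) (hw0 : ∀ x, 0 < w x)
    (hwm : Measurable w) (hw : ∀ i x, w (t i x) = w x) (hq0 : ∀ x, 0 < q x) (hqm : Measurable q)
    (hqi : Integrable q μ) (hq1 : ∫ z, q z ∂μ = 1) (x : X) :
    ∫ z, (1 - imhAcceptQ w (fun s => (∑ i, q (t i s)) / Fintype.card ι) x z)
        * ((∑ i, q (t i z)) / Fintype.card ι) ∂μ
      ≤ (∑ i, ∫ z, (1 - imhAcceptQ w q (t i x) z) * q z ∂μ) / Fintype.card ι := by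
  have hN : (0 : ℝ) < Fintype.card ι := by exact_mod_cast Fintype.card_pos
  obtain ⟨hs0, hsm, hsi, hs1⟩ := groupAvg_facts ht hq0 hqm hqi hq1
  rw [rejection_eq_one_sub hw0 hwm hs0 hsm hsi hs1]
  have hri : ∀ i, ∫ z, (1 - imhAcceptQ w q (t i x) z) * q z ∂μ
      = 1 - ∫ z, min (q z) (w z * (q (t i x) / w (t i x))) ∂μ :=
    fun i => rejection_eq_one_sub hw0 hwm hq0 hqm hqi hq1 (t i x)
  simp_rw [hri]
  -- each accepted mass from `t_i x`, rewritten as an integral of a `t_i`-shifted integrand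
  have hshift : ∀ i, ∫ z, min (q z) (w z * (q (t i x) / w (t i x))) ∂μ
      = ∫ z, min (q (t i z)) (w z * (q (t i x) / w x)) ∂μ := fun i => by
    rw [hw i x, ← integral_comp_symmetry ht i (fun z => min (q z) (w z * (q (t i x) / w x)))]
    exact integral_congr_ae (Eventually.of_forall fun z => by simp only [hw i z])
  simp_rw [hshift]
  have hIi : ∀ i, Integrable (fun z => min (q (t i z)) (w z * (q (t i x) / w x))) μ := fun i => by
    refine Integrable.mono' (integrable_comp_symmetry ht i hqi)
      ((hqm.comp (t i).measurable).min (hwm.mul_const _)).aestronglyMeasurable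
      (Eventually.of_forall fun z => ?_)
    have hc : 0 ≤ q (t i x) / w x := (div_pos (hq0 _) (hw0 x)).le
    rw [Real.norm_eq_abs, abs_of_nonneg (le_min (hq0 _).le (mul_nonneg (hw0 z).le hc))]
    exact min_le_left _ _
  have hIs := integrable_min_density hw0 hwm hs0 hsm hsi (div_pos (hs0 x) (hw0 x)).le
  -- pointwise superadditivity of `min` over the family
  have hpt : ∀ z, (∑ i, min (q (t i z)) (w z * (q (t i x) / w x))) / Fintype.card ι
      ≤ min ((∑ i, q (t i z)) / Fintype.card ι)
          (w z * ((∑ i, q (t i x)) / Fintype.card ι / w x)) := fun z => by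
    have h := Literature.Probability.MarkovChains.sum_min_le_min_sum Finset.univ
      (fun i => q (t i z)) (fun i => w z * (q (t i x) / w x))
    have e : w z * ((∑ i, q (t i x)) / Fintype.card ι / w x)
        = (∑ i, w z * (q (t i x) / w x)) / Fintype.card ι := by
      rw [← Finset.mul_sum, ← Finset.sum_div]; ring
    rw [e, min_div_div_right hN.le]
    exact div_le_div_of_nonneg_right h hN.le
  have hle : (∑ i, ∫ z, min (q (t i z)) (w z * (q (t i x) / w x)) ∂μ) / Fintype.card ι
      ≤ ∫ z, min ((∑ i, q (t i z)) / Fintype.card ι)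
          (w z * ((∑ i, q (t i x)) / Fintype.card ι / w x)) ∂μ := by
    rw [← integral_finsetSum Finset.univ fun i _ => hIi i, ← integral_div]
    exact integral_mono ((integrable_finsetSum Finset.univ fun i _ => hIi i).div_const _) hIs hpt
  -- `1 − ∫ min(q̄ …) ≤ N⁻¹ Σ (1 − ∫ …)` since `Σ_i 1 = N`
  have e1 : (∑ i, (1 - ∫ z, min (q (t i z)) (w z * (q (t i x) / w x)) ∂μ)) / Fintype.card ι
      = 1 - (∑ i, ∫ z, min (q (t i z)) (w z * (q (t i x) / w x)) ∂μ) / Fintype.card ι := by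
    rw [Finset.sum_sub_distrib, Finset.sum_const, Finset.card_univ, nsmul_eq_mul, mul_one]
    field_simp
  rw [e1]
  linarith

/-- **THE MEAN REJECTION RATE NEVER INCREASES**: `∫ r_q̄ w ≤ ∫ r_q̃ w` (acceptance `ā` never drops). -/
theorem groupAvg_meanRejection_le (ht : ∀ i, MeasurePreserving (t i) μ μ) (hw0 : ∀ x, 0 < w x)
    (hwm : Measurable w) (hwi : Integrable w μ) (hw : ∀ i x, w (t i x) = w x) (hq0 : ∀ x, 0 < q x)
    (hqm : Measurable q) (hqi : Integrable q μ) (hq1 : ∫ z, q z ∂μ = 1) :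
    ∫ x, (∫ z, (1 - imhAcceptQ w (fun s => (∑ i, q (t i s)) / Fintype.card ι) x z)
        * ((∑ i, q (t i z)) / Fintype.card ι) ∂μ) * w x ∂μ
      ≤ ∫ x, (∫ z, (1 - imhAcceptQ w q x z) * q z ∂μ) * w x ∂μ := by
  have hN : (0 : ℝ) < Fintype.card ι := by exact_mod_cast Fintype.card_pos
  obtain ⟨hs0, hsm, hsi, hs1⟩ := groupAvg_facts ht hq0 hqm hqi hq1
  obtain ⟨hr0, hr1, hrm⟩ := rejection_bounds (μ := μ) hw0 hwm hq0 hqm hqi hq1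
  obtain ⟨hs0', hs1', hsm'⟩ := rejection_bounds (μ := μ) hw0 hwm hs0 hsm hsi hs1
  set r : X → ℝ := fun x => ∫ z, (1 - imhAcceptQ w q x z) * q z ∂μ with hr
  set rs : X → ℝ := fun x => ∫ z, (1 - imhAcceptQ w (fun s => (∑ i, q (t i s)) / Fintype.card ι) x z)
    * ((∑ i, q (t i z)) / Fintype.card ι) ∂μ with hrs
  have hrw : Integrable (fun x => r x * w x) μ := by
    refine Integrable.mono' hwi (hrm.mul hwm).aestronglyMeasurable (Eventually.of_forall fun x => ?_)
    rw [Real.norm_eq_abs, abs_of_nonneg (mul_nonneg (hr0 x) (hw0 x).le)]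
    exact mul_le_of_le_one_left (hw0 x).le (hr1 x)
  have hrsw : Integrable (fun x => rs x * w x) μ := by
    refine Integrable.mono' hwi (hsm'.mul hwm).aestronglyMeasurable (Eventually.of_forall fun x => ?_)
    rw [Real.norm_eq_abs, abs_of_nonneg (mul_nonneg (hs0' x) (hw0 x).le)]
    exact mul_le_of_le_one_left (hw0 x).le (hs1' x)
  have hriw : ∀ i, Integrable (fun x => r (t i x) * w x) μ := fun i => by
    have h := integrable_comp_symmetry ht i hrw
    exact h.congr (Eventually.of_forall fun x => by simp only [hw i])
  have hint_i : ∀ i, ∫ x, r (t i x) * w x ∂μ = ∫ x, r x * w x ∂μ := fun i => by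
    rw [← integral_comp_symmetry ht i (fun x => r x * w x)]
    exact integral_congr_ae (Eventually.of_forall fun x => by simp only [hw i])
  have hpt : ∀ x, rs x * w x ≤ (∑ i, r (t i x) * w x) / Fintype.card ι := fun x => by
    have h := groupAvg_rejection_le ht hw0 hwm hw hq0 hqm hqi hq1 x
    rw [← Finset.sum_mul, mul_div_right_comm]
    exact mul_le_mul_of_nonneg_right h (hw0 x).le
  calc ∫ x, rs x * w x ∂μ ≤ ∫ x, (∑ i, r (t i x) * w x) / Fintype.card ι ∂μ :=
        integral_mono hrsw ((integrable_finsetSum Finset.univ fun i _ => hriw i).div_const _) hpt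
    _ = ∫ x, r x * w x ∂μ := by
        rw [integral_div, integral_finsetSum Finset.univ fun i _ => hriw i]
        simp only [hint_i, Finset.sum_const, Finset.card_univ, nsmul_eq_mul]
        field_simp

/-! ## Importance-weight moment -/

omit [SFinite μ] in
/-- **THE IMPORTANCE-WEIGHT SECOND MOMENT NEVER INCREASES**: `∫ (w/q̃) w < ∞ ⇒ ∫ (w/q̄) w ≤ ∫ (w/q̃) w`
(finite) — `N`-point AM–HM and `∫ F ∘ t_i = ∫ F`. -/
theorem groupAvg_weightMoment_le (ht : ∀ i, MeasurePreserving (t i) μ μ) (hw0 : ∀ x, 0 < w x)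
    (hwm : Measurable w) (hw : ∀ i x, w (t i x) = w x) (hq0 : ∀ x, 0 < q x) (hqm : Measurable q)
    (hW : Integrable (fun x => w x / q x * w x) μ) :
    Integrable (fun x => w x / ((∑ i, q (t i x)) / Fintype.card ι) * w x) μ ∧
    ∫ x, w x / ((∑ i, q (t i x)) / Fintype.card ι) * w x ∂μ ≤ ∫ x, w x / q x * w x ∂μ := by
  have hN : (0 : ℝ) < Fintype.card ι := by exact_mod_cast Fintype.card_pos
  have hWi : ∀ i, Integrable (fun x => w x / q (t i x) * w x) μ := fun i => by
    have h := integrable_comp_symmetry ht i hW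
    exact h.congr (Eventually.of_forall fun x => by simp only [hw i])
  have hint_i : ∀ i, ∫ x, w x / q (t i x) * w x ∂μ = ∫ x, w x / q x * w x ∂μ := fun i => by
    rw [← integral_comp_symmetry ht i (fun x => w x / q x * w x)]
    exact integral_congr_ae (Eventually.of_forall fun x => by simp only [hw i])
  have hs0 : ∀ x, 0 < (∑ i, q (t i x)) / Fintype.card ι := fun x =>
    div_pos (Finset.sum_pos (fun i _ => hq0 _) Finset.univ_nonempty) hN
  have hnn : ∀ x, 0 ≤ w x / ((∑ i, q (t i x)) / Fintype.card ι) * w x := fun x =>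
    mul_nonneg (div_nonneg (hw0 x).le (hs0 x).le) (hw0 x).le
  have hpt : ∀ x, w x / ((∑ i, q (t i x)) / Fintype.card ι) * w x
      ≤ (∑ i, w x / q (t i x) * w x) / Fintype.card ι := fun x => by
    have h := inv_avg_le_avg_inv (a := fun i => q (t i x)) fun i => hq0 _
    have hw2 : 0 ≤ w x * w x := mul_nonneg (hw0 x).le (hw0 x).le
    have e1 : w x / ((∑ i, q (t i x)) / Fintype.card ι) * w x
        = (1 / ((∑ i, q (t i x)) / Fintype.card ι)) * (w x * w x) := by ring
    have e2 : (∑ i, w x / q (t i x) * w x) / Fintype.card ι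
        = ((∑ i, 1 / q (t i x)) / Fintype.card ι) * (w x * w x) := by
      rw [Finset.sum_div, Finset.sum_div, Finset.sum_mul]
      refine Finset.sum_congr rfl fun i _ => ?_
      ring
    rw [e1, e2]
    exact mul_le_mul_of_nonneg_right h hw2
  have hint : Integrable (fun x => w x / ((∑ i, q (t i x)) / Fintype.card ι) * w x) μ := by
    refine Integrable.mono'
      ((integrable_finsetSum Finset.univ fun i _ => hWi i).div_const (Fintype.card ι : ℝ))
      ((hwm.div ((Finset.measurable_sum _ fun i _ => hqm.comp (t i).measurable).div_const _)).mul
        hwm).aestronglyMeasurable (Eventually.of_forall fun x => ?_)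
    rw [Real.norm_eq_abs, abs_of_nonneg (hnn x)]
    exact hpt x
  refine ⟨hint, ?_⟩
  calc ∫ x, w x / ((∑ i, q (t i x)) / Fintype.card ι) * w x ∂μ
      ≤ ∫ x, (∑ i, w x / q (t i x) * w x) / Fintype.card ι ∂μ :=
        integral_mono hint ((integrable_finsetSum Finset.univ fun i _ => hWi i).div_const _) hpt
    _ = ∫ x, w x / q x * w x ∂μ := by
        rw [integral_div, integral_finsetSum Finset.univ fun i _ => hWi i]
        simp only [hint_i, Finset.sum_const, Finset.card_univ, nsmul_eq_mul]
        field_simp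

/-! ## Sticking column -/

/-- **THE STICKING COLUMN NEVER INCREASES** for every observable with `g² ∘ t_i = g²` (all `i`):
`∫ g² w r_q̃/(1 − r_q̃) < ∞ ⇒ ∫ g² w r_q̄/(1 − r_q̄) ≤ ∫ g² w r_q̃/(1 − r_q̃)` (finite). -/
theorem groupAvg_stickingColumn_le (ht : ∀ i, MeasurePreserving (t i) μ μ) (hw0 : ∀ x, 0 < w x)
    (hwm : Measurable w) (hw : ∀ i x, w (t i x) = w x) (hq0 : ∀ x, 0 < q x) (hqm : Measurable q)
    (hqi : Integrable q μ) (hq1 : ∫ z, q z ∂μ = 1) {g : X → ℝ} (hgm : Measurable g)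
    (hg : ∀ i x, g (t i x) ^ 2 = g x ^ 2)
    (hS : Integrable (fun x => g x ^ 2 * w x * ((∫ z, (1 - imhAcceptQ w q x z) * q z ∂μ)
      / (1 - ∫ z, (1 - imhAcceptQ w q x z) * q z ∂μ))) μ) :
    Integrable (fun x => g x ^ 2 * w x
        * ((∫ z, (1 - imhAcceptQ w (fun s => (∑ i, q (t i s)) / Fintype.card ι) x z)
            * ((∑ i, q (t i z)) / Fintype.card ι) ∂μ)
          / (1 - ∫ z, (1 - imhAcceptQ w (fun s => (∑ i, q (t i s)) / Fintype.card ι) x z)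
            * ((∑ i, q (t i z)) / Fintype.card ι) ∂μ))) μ ∧
    ∫ x, g x ^ 2 * w x
        * ((∫ z, (1 - imhAcceptQ w (fun s => (∑ i, q (t i s)) / Fintype.card ι) x z)
            * ((∑ i, q (t i z)) / Fintype.card ι) ∂μ)
          / (1 - ∫ z, (1 - imhAcceptQ w (fun s => (∑ i, q (t i s)) / Fintype.card ι) x z)
            * ((∑ i, q (t i z)) / Fintype.card ι) ∂μ)) ∂μ
      ≤ ∫ x, g x ^ 2 * w x * ((∫ z, (1 - imhAcceptQ w q x z) * q z ∂μ)
          / (1 - ∫ z, (1 - imhAcceptQ w q x z) * q z ∂μ)) ∂μ := by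
  have hN : (0 : ℝ) < Fintype.card ι := by exact_mod_cast Fintype.card_pos
  obtain ⟨hs0, hsm, hsi, hs1⟩ := groupAvg_facts ht hq0 hqm hqi hq1
  obtain ⟨hr0, -, hrm⟩ := rejection_bounds (μ := μ) hw0 hwm hq0 hqm hqi hq1
  obtain ⟨hs0', hs1', hsm'⟩ := rejection_bounds (μ := μ) hw0 hwm hs0 hsm hsi hs1
  set r : X → ℝ := fun x => ∫ z, (1 - imhAcceptQ w q x z) * q z ∂μ with hr
  set rs : X → ℝ := fun x => ∫ z, (1 - imhAcceptQ w (fun s => (∑ i, q (t i s)) / Fintype.card ι) x z)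
    * ((∑ i, q (t i z)) / Fintype.card ι) ∂μ with hrs
  have hrlt : ∀ x, r x < 1 := fun x => by
    show (∫ z, (1 - imhAcceptQ w q x z) * q z ∂μ) < 1
    rw [rejection_eq_rejCurve hw0 hq0 x]
    exact rejCurve_lt_one hw0 hwm hq0 hqm hqi hq1 (div_pos (hw0 x) (hq0 x))
  set A : X → ℝ := fun x => g x ^ 2 * w x * (r x / (1 - r x)) with hA
  have hAi : ∀ i, Integrable (fun x => A (t i x)) μ := fun i => integrable_comp_symmetry ht i hS
  have hA_eq : ∀ i x, A (t i x) = g x ^ 2 * w x * (r (t i x) / (1 - r (t i x))) := fun i x => by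
    show g (t i x) ^ 2 * w (t i x) * (r (t i x) / (1 - r (t i x)))
      = g x ^ 2 * w x * (r (t i x) / (1 - r (t i x)))
    rw [hg i x, hw i x]
  have hint_i : ∀ i, ∫ x, A (t i x) ∂μ = ∫ x, A x ∂μ := fun i => integral_comp_symmetry ht i A
  have hgw0 : ∀ x, 0 ≤ g x ^ 2 * w x := fun x => mul_nonneg (sq_nonneg _) (hw0 x).le
  have hnn : ∀ x, 0 ≤ g x ^ 2 * w x * (rs x / (1 - rs x)) := fun x =>
    mul_nonneg (hgw0 x) (div_nonneg (hs0' x) (sub_nonneg.2 (hs1' x)))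
  have hpt : ∀ x, g x ^ 2 * w x * (rs x / (1 - rs x)) ≤ (∑ i, A (t i x)) / Fintype.card ι := by
    intro x
    have hodds := odds_le_avg_odds (r := fun i => r (t i x)) (fun i => hrlt _)
      (groupAvg_rejection_le ht hw0 hwm hw hq0 hqm hqi hq1 x)
    have e : (∑ i, A (t i x)) / Fintype.card ι
        = g x ^ 2 * w x * ((∑ i, r (t i x) / (1 - r (t i x))) / Fintype.card ι) := by
      simp only [hA_eq]
      rw [← Finset.mul_sum]
      ring
    rw [e]
    exact mul_le_mul_of_nonneg_left hodds (hgw0 x)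
  have hint : Integrable (fun x => g x ^ 2 * w x * (rs x / (1 - rs x))) μ := by
    refine Integrable.mono'
      ((integrable_finsetSum Finset.univ fun i _ => hAi i).div_const (Fintype.card ι : ℝ))
      (((hgm.pow_const 2).mul hwm).mul (hsm'.div (measurable_const.sub hsm'))).aestronglyMeasurable
      (Eventually.of_forall fun x => ?_)
    rw [Real.norm_eq_abs, abs_of_nonneg (hnn x)]
    exact hpt x
  refine ⟨hint, ?_⟩
  calc ∫ x, g x ^ 2 * w x * (rs x / (1 - rs x)) ∂μ ≤ ∫ x, (∑ i, A (t i x)) / Fintype.card ι ∂μ :=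
        integral_mono hint ((integrable_finsetSum Finset.univ fun i _ => hAi i).div_const _) hpt
    _ = ∫ x, A x ∂μ := by
        rw [integral_div, integral_finsetSum Finset.univ fun i _ => hAi i]
        simp only [hint_i, Finset.sum_const, Finset.card_univ, nsmul_eq_mul]
        field_simp

/-! ## Orbit cover ⇒ uniform ergodicity -/

omit [MeasurableSpace X] [SFinite μ] in
/-- **ORBIT COVER ⇒ WEIGHT BOUND**: if every `x` has SOME `i` with `w(x) ≤ C q̃(t_i x)`, then
`w ≤ N C q̄` everywhere. -/
theorem groupAvg_weightBound_of_orbitCover {t : ι → X → X} (hw0 : ∀ x, 0 < w x)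
    (hq0 : ∀ x, 0 < q x) {C : ℝ} (hC : ∀ x, ∃ i, w x ≤ C * q (t i x)) (x : X) :
    w x ≤ Fintype.card ι * C * ((∑ i, q (t i x)) / Fintype.card ι) := by
  have hN : (0 : ℝ) < Fintype.card ι := by exact_mod_cast Fintype.card_pos
  obtain ⟨i, hi⟩ := hC x
  have hC0 : 0 ≤ C := by
    by_contra h
    have : C * q (t i x) < 0 := mul_neg_of_neg_of_pos (lt_of_not_ge h) (hq0 _)
    linarith [hw0 x]
  have hle : q (t i x) ≤ ∑ j, q (t j x) :=
    Finset.single_le_sum (fun j _ => (hq0 (t j x)).le) (Finset.mem_univ i)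
  calc w x ≤ C * q (t i x) := hi
    _ ≤ C * ∑ j, q (t j x) := mul_le_mul_of_nonneg_left hle hC0
    _ = Fintype.card ι * C * ((∑ j, q (t j x)) / Fintype.card ι) := by
        field_simp

/-- **AN ORBIT-COVERING FLOW, AVERAGED, IS UNIFORMLY ERGODIC**: `∀ x ∃ i, w(x) ≤ C q̃(t_i x)` ⇒ for
every centred square-integrable `g` with `∫ g² w > 0`, the normalised series under `imhOp μ w q̄` is
summable and `τ_int ≤ N C/Z − ½`. -/
theorem groupAvg_tauInt_le_of_orbitCover (ht : ∀ i, MeasurePreserving (t i) μ μ)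
    (hw0 : ∀ x, 0 < w x) (hwm : Measurable w) (hwi : Integrable w μ)
    (hq0 : ∀ x, 0 < q x) (hqm : Measurable q) (hqi : Integrable q μ) (hq1 : ∫ z, q z ∂μ = 1)
    {C : ℝ} (hC : ∀ x, ∃ i, w x ≤ C * q (t i x)) {g : X → ℝ} (hgm : Measurable g)
    (hg2 : Integrable (fun x => g x ^ 2 * w x) μ) (hg0 : ∫ x, g x * w x ∂μ = 0)
    (hP : 0 < ∫ x, g x ^ 2 * w x ∂μ) :
    (Summable fun n => (∫ x, g x * ((imhOp μ w (fun s => (∑ i, q (t i s)) / Fintype.card ι))^[n + 1]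
        g) x * w x ∂μ) / ∫ x, g x ^ 2 * w x ∂μ) ∧
    tauInt (fun n => (∫ x, g x * ((imhOp μ w (fun s => (∑ i, q (t i s)) / Fintype.card ι))^[n] g) x
        * w x ∂μ) / ∫ x, g x ^ 2 * w x ∂μ)
      ≤ 1 / ((∫ x, w x ∂μ) / (Fintype.card ι * C)) - 1 / 2 := by
  obtain ⟨hs0, hsm, hsi, hs1⟩ := groupAvg_facts ht hq0 hqm hqi hq1
  exact imhOp_tauInt_le_weightBound_of_sq hw0 hwm hwi hs0 hsm hsi hs1
    (fun x => groupAvg_weightBound_of_orbitCover (t := fun i => (t i : X → X)) hw0 hq0 hC x)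
    hgm hg2 hg0 hP

end General

end Summit.Ventures.LatticeQCDFlow.Exactness
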